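import Summits.PneNP.PneNP.Theorems.SymmetryBudgetWindowBarrierEntropyGameCircuitGates

/-!
# Completeness of the entropy game, IIIb: semantics of the coset-refinement circuit — the rounds
(dichotomy `WindowBarrier` stmt-PneNP-2145 / `NoHiddenOrder` stmt-PneNP-14781, route `PneNP/SymmetryBudget`)

Continuation of `…EntropyGameCircuitGates.lean`:

* **`CosetGame.val_rel`** — `rel r A P Q` fires on `x` iff `Rel K r A (Gr x) P.out H Q.out` (induction on
  `r`; the step is the counting form of the moves, `CosetGame.exists_equiv_iff_forall_card_eq` of
  `…EntropyGameHall.lean`, the classes being compared at the target's positions `D`, where `Rel` is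
  constant on cosets by `Rel.mul_mem_left/right`; the point clause is the two-class Hall
  `CosetGame.exists_equiv_iff_card_filter_eq`);
* `CosetGame.val_out`, **`CosetGame.compile_crDAG_eval_iff`** — the compiled circuit accepts `x` iff
  some pair of one-block positions of `Gr x` and `H` is related at round `T`.
-/

-- `Summit.PneNP.PneNP.…` duplicates `PneNP` BY DESIGN (single-problem summit).
set_option linter.dupNamespace false

namespace Summit.PneNP.PneNP.Theorems

open Finset Literature.Computability.Complexity
open scoped Classical

namespace CosetGame

variable {n K T : ℕ}

noncomputable section

open Node

section Values

variable (H : SimpleGraph (Fin n)) (x : Fin n × Fin n → Bool)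

local notation "Gx" => (SimpleGraph.fromRel fun a b : Fin n => x (a, b) = true)

/-! ### The induction over the rounds -/

/-- Round-`r` equivalence at a fixed type, as a relation on (graph, relabelling) pairs — the
equivalence relation to which the counting form of the moves is applied. -/
theorem rel_equivalence (r : ℕ) (B : Subgroup (Equiv.Perm (Fin n))) :
    Equivalence fun p₁ p₂ : SimpleGraph (Fin n) × Equiv.Perm (Fin n) => Rel K r B p₁.1 p₁.2 p₂.1 p₂.2 :=
  ⟨fun p => Rel.refl r B p.1 p.2, fun h => Rel.symm r h, fun h₁ h₂ => Rel.trans r h₁ h₂⟩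

/-- **The block clause in counting form**: for a type `B`, a bijection `e` of `A` with
`Rel r B G (β ρ) H (γ (e ρ))` exists iff, for every target position `D` of type `B`, as many `ρ ∈ A`
carry `β` as carry `γ` to a round-`r` equivalent of `D.out`. -/
theorem exists_equiv_rel_iff (r : ℕ) {A : Ty n K} (B : Ty n K) (G : SimpleGraph (Fin n))
    (β γ : Equiv.Perm (Fin n)) :
    (∃ e : A.1 ≃ A.1, ∀ ρ : A.1, Rel K r B.1 G (β * ρ) H (γ * e ρ)) ↔
      ∀ D : Cos B, (univ.filter fun ρ : A.1 => Rel K r B.1 G (β * ρ) H D.out).card =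
        (univ.filter fun ρ : A.1 => Rel K r B.1 H (γ * ρ) H D.out).card := by
  have hS := rel_equivalence (K := K) (n := n) r B.1
  constructor
  · rintro ⟨e, he⟩ D
    exact card_filter_eq_of_exists_equiv (α := A.1) (fun p₁ p₂ : SimpleGraph (Fin n) × Equiv.Perm (Fin n) =>
      Rel K r B.1 p₁.1 p₁.2 p₂.1 p₂.2) hS (fun ρ : A.1 => (G, β * (ρ : Equiv.Perm (Fin n))))
      (fun ρ : A.1 => (H, γ * (ρ : Equiv.Perm (Fin n)))) e he (H, D.out)
  · intro h
    refine (exists_equiv_iff_forall_card_eq (α := A.1) (fun p₁ p₂ : SimpleGraph (Fin n) × Equiv.Perm (Fin n) =>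
      Rel K r B.1 p₁.1 p₁.2 p₂.1 p₂.2) hS (fun ρ : A.1 => (G, β * (ρ : Equiv.Perm (Fin n))))
      (fun ρ : A.1 => (H, γ * (ρ : Equiv.Perm (Fin n))))).2 fun b => ?_
    -- compare at the coset of `γ b`
    obtain ⟨d, hd⟩ := QuotientGroup.mk_out_eq_mul B.1 (γ * b)
    have e1 : (univ.filter fun ρ : A.1 => Rel K r B.1 G (β * ρ) H (γ * b)) =
        univ.filter fun ρ : A.1 => Rel K r B.1 G (β * ρ) H (QuotientGroup.mk (γ * b) : Cos B).out := by
      refine Finset.filter_congr fun ρ _ => ?_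
      rw [hd, Rel.mul_mem_right r d.2]
    have e2 : (univ.filter fun ρ : A.1 => Rel K r B.1 H (γ * ρ) H (γ * b)) =
        univ.filter fun ρ : A.1 => Rel K r B.1 H (γ * ρ) H (QuotientGroup.mk (γ * b) : Cos B).out := by
      refine Finset.filter_congr fun ρ _ => ?_
      rw [hd, Rel.mul_mem_right r d.2]
    simp only
    rw [e1, e2]
    exact h _

/-- **The `rel` gates compute the canonical refinement**: for every round `r ≤ T`, type `A` and
positions `P`, `Q`, the gate `rel r A P Q` fires on `x` iff `Rel K r A (Gr x) P.out H Q.out`. -/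
theorem val_rel : ∀ (r : ℕ) (hr : r < T + 1) (A : Ty n K) (P Q : Cos A),
    (crDAG K T H).val x (rel ⟨r, hr⟩ A P Q) = true ↔ Rel K r A.1 (Gx) P.out H Q.out
  | 0, h0, A, P, Q => by
    rw [val_node]
    show decide (∀ a : Fin 0, GateDAG.wire x ((crDAG K T H).val x) (Fin.elim0 a) = true) = true ↔ True
    simp
  | r + 1, hr, A, P, Q => by
    have hr' : r < T := by omega
    have IH : ∀ (B : Ty n K) (P' Q' : Cos B), (crDAG K T H).val x (rel ⟨r, by omega⟩ B P' Q') = true ↔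
        Rel K r B.1 (Gx) P'.out H Q'.out := fun B P' Q' => val_rel r (by omega) B P' Q'
    rw [val_rel_succ, Rel.succ_iff, IH]
    refine and_congr_right fun _ => and_congr ?_ ?_
    · -- block clauses: the circuit's count at `(B, D)` is the count of the refinement
      have hcnt : ∀ (B : Ty n K) (D : Cos B),
          (univ.filter fun i : Fin (cardA A) =>
              (crDAG K T H).val x (rel (Fin.castSucc ⟨r, hr'⟩) B (child P B i) D) = true).card =
            (univ.filter fun ρ : A.1 => Rel K r B.1 (Gx) (P.out * ρ) H D.out).card := by
        intro B D
        refine (card_filter_iff _ _ _ fun i => ?_).trans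
          (card_filter_enumA (fun ρ : A.1 => Rel K r B.1 (Gx) (P.out * ρ) H D.out))
        show (crDAG K T H).val x (rel ⟨r, _⟩ B (child P B i) D) = true ↔ _
        refine (IH B _ D).trans ?_
        obtain ⟨b, hb⟩ := QuotientGroup.mk_out_eq_mul B.1 (P.out * (enumA A i : Equiv.Perm (Fin n)))
        show Rel K r B.1 (Gx) (QuotientGroup.mk (P.out * (enumA A i : Equiv.Perm (Fin n))) : Cos B).out H D.out ↔ _
        rw [hb]
        exact Rel.mul_mem_left r b.2
      constructor
      · intro h B hB
        refine (exists_equiv_rel_iff H r ⟨B, hB⟩ (Gx) P.out Q.out).2 fun D => ?_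
        have h1 := (val_beq H x ⟨r, hr'⟩ P Q ⟨⟨B, hB⟩, D⟩).1 (h ⟨⟨B, hB⟩, D⟩)
        exact (hcnt ⟨B, hB⟩ D).symm.trans h1
      · rintro h ⟨B, D⟩
        obtain ⟨e, he⟩ := h B.1 B.2
        have h2 := (exists_equiv_rel_iff H r B (Gx) P.out Q.out).1 ⟨e, he⟩ D
        exact (val_beq H x ⟨r, hr'⟩ P Q ⟨B, D⟩).2 ((hcnt B D).trans h2)
    · -- point clauses
      refine forall_congr' fun q => ?_
      refine (val_peq H x P Q q).trans ?_
      refine Iff.trans ?_ (exists_equiv_iff_card_filter_eq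
        (fun ρ : A.1 => (Gx).Adj ((P.out * ρ) q.1) ((P.out * ρ) q.2))
        (fun ρ : A.1 => H.Adj ((Q.out * ρ) q.1) ((Q.out * ρ) q.2))).symm
      have e1 := card_plit (T := T) H x P q
      have e2 : mP H Q q = (univ.filter fun ρ : A.1 => H.Adj ((Q.out * ρ) q.1) ((Q.out * ρ) q.2)).card :=
        card_filter_iff _ _ _ fun _ => Iff.rfl
      constructor
      · intro h; exact e1.symm.trans (h.trans e2)
      · intro h; exact e1.trans (h.trans e2.symm)

/-! ### The output -/

/-- **The output fires iff some pair of one-block positions is related at round `T`.** -/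
theorem val_out : (crDAG K T H).val x out = true ↔
    ∃ β γ : Equiv.Perm (Fin n), Rel K T (blockGroup fun _ : Fin n => 0) (Gx) β H γ := by
  rw [val_node]
  show (GateFn.or (Fintype.card (Cos (ty₀ n K) × Cos (ty₀ n K)))).2 (fun c => GateDAG.wire x ((crDAG K T H).val x)
    (Sum.inr (rel (Fin.last T) (ty₀ n K) (enumOut n K c).1 (enumOut n K c).2))) = true ↔ _
  rw [or_fin_iff]
  simp only [GateDAG.wire_inr]
  rw [(enumOut n K).exists_congr_right (q := fun PQ => (crDAG K T H).val x (rel (Fin.last T) (ty₀ n K) PQ.1 PQ.2) = true)]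
  constructor
  · rintro ⟨⟨P, Q⟩, h⟩
    exact ⟨P.out, Q.out, (val_rel H x T (Nat.lt_succ_self T) (ty₀ n K) P Q).1 h⟩
  · rintro ⟨β, γ, h⟩
    refine ⟨⟨QuotientGroup.mk β, QuotientGroup.mk γ⟩, (val_rel H x T (Nat.lt_succ_self T) (ty₀ n K) _ _).2 ?_⟩
    obtain ⟨a, ha⟩ := QuotientGroup.mk_out_eq_mul (ty₀ n K).1 β
    obtain ⟨b, hb⟩ := QuotientGroup.mk_out_eq_mul (ty₀ n K).1 γ
    show Rel K T (blockGroup fun _ : Fin n => 0) (Gx) (QuotientGroup.mk β : Cos (ty₀ n K)).out H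
      (QuotientGroup.mk γ : Cos (ty₀ n K)).out
    rw [ha, hb]
    exact (Rel.mul_mem_left (A := blockGroup fun _ : Fin n => 0) T a.2).2
      ((Rel.mul_mem_right (A := blockGroup fun _ : Fin n => 0) T b.2).2 h)

/-- **The compiled circuit accepts `x` iff some pair of one-block positions of `Gr x` and `H` is
related at round `T`.** -/
theorem compile_crDAG_eval_iff : (crDAG K T H).compile.eval x = true ↔
    ∃ β γ : Equiv.Perm (Fin n), Rel K T (blockGroup fun _ : Fin n => 0) (Gx) β H γ := by
  rw [GateDAG.compile_eval, GateDAG.evalOut, crDAG_out, GateDAG.wire_inr, val_out]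

end Values

end

end CosetGame

end Summit.PneNP.PneNP.Theorems
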